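import Literature.NumberTheory.Transcendental.HeightLocalGlobal
import Literature.NumberTheory.Transcendental.QuadraticRelationsLogarithmsWeilHeight
import HarnessLib

/-!
# Roy–Waldschmidt 1997, §3: height estimates for the proof of Théorème 3.1

D. Roy, M. Waldschmidt, *Approximation diophantienne et indépendance algébrique de logarithmes*,
Ann. Sci. ÉNS (4) 30 (1997) 753–796, proof of Théorème 3.1, p. 765: "le lemme 3.3 livre
`h₁(ã) ≤ κ/2 + c₁ ≤ κ`".  In place of the paper's Lemme 3.3 (heights under a finite projection of a
curve, Serre's *Lectures on the Mordell–Weil theorem* §2.3) we use the explicit description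
`ãᵢ = Gᵢ(α, β̃)/Qᵢ(α)` of the reduced point and elementary height inequalities, in the (relative)
heights `Height.logHeight₁` of Mathlib on a number field `F` (`[F:ℚ] · h`):

* `logHeight₁_sum_mul_pow_mul_pow_le` — `h(P(α, β)) ≤ [F:ℚ] log L(P) + deg_X P · h(α) + deg_Y P · h(β)`
  (logarithmic form of `mulHeight₁_sum_mul_pow_mul_pow_le` of `…HeightLocalGlobal`);
* `logHeight₁_root_le_of_monic` — a root `y` of a monic `y^D + ∑_{k<D} b_k y^k = 0` has
  `h(y) ≤ [F:ℚ] log D + ∑_k h(b_k)`;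
* `logHeight₁_div_le` — `h(x/y) ≤ h(x) + h(y)`;
* `logHeight_optionElim_le_sum`, `weilHeight₁_le_sum_single` — the affine height of a tuple is at
  most the sum of the heights of its entries (a sub-tuple of the Segre "multiplication table",
  Mathlib's `logHeight_fun_prod_eq`).

Everything is proved; no definitions, no named facts.

## References

* [RoyWaldschmidt1997ENS] D. Roy, M. Waldschmidt, Ann. Sci. ÉNS (4) 30 (1997) 753–796, §3 (i), p. 765.
* M. Waldschmidt, *Diophantine Approximation on Linear Algebraic Groups*, Springer 2000, §3.2.
-/

noncomputable section

open Height Height.AdmissibleAbsValues Finset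

namespace Literature.NumberTheory.Transcendental

namespace RoyWaldschmidt1997

section general

variable {F : Type*} [Field F] [AdmissibleAbsValues F]

/-- **`h(P(α, β)) ≤ [F:ℚ] log max(1, L(P)) + D₁ h(α) + D₂ h(β)`** for an integer polynomial of
bidegree `≤ (D₁, D₂)`. [cite: NesterenkoPhilippon2001, Ch. 2, Lemma 2.10] -/
theorem logHeight₁_sum_mul_pow_mul_pow_le {s : Finset (ℕ × ℕ)} (a : ℕ × ℕ → ℤ) (α β : F)
    {D₁ D₂ : ℕ} (hD : ∀ p ∈ s, p.1 ≤ D₁ ∧ p.2 ≤ D₂) :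
    logHeight₁ (∑ p ∈ s, (a p : F) * α ^ p.1 * β ^ p.2) ≤
      totalWeight F * Real.log (max 1 (∑ p ∈ s, |(a p : ℝ)|)) + D₁ * logHeight₁ α + D₂ * logHeight₁ β := by
  have h := mulHeight₁_sum_mul_pow_mul_pow_le a α β hD
  have hM : 0 < max 1 (∑ p ∈ s, |(a p : ℝ)|) := lt_of_lt_of_le one_pos (le_max_left _ _)
  have hlog := Real.log_le_log (mulHeight₁_pos _) h
  rw [Real.log_mul (by positivity) (by positivity), Real.log_mul (by positivity) (by positivity),
    Real.log_pow, Real.log_pow, Real.log_pow] at hlog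
  simpa only [logHeight₁_eq_log_mulHeight₁] using hlog

/-- `h(x / y) ≤ h(x) + h(y)`. [folklore] -/
theorem logHeight₁_div_le (x y : F) : logHeight₁ (x / y) ≤ logHeight₁ x + logHeight₁ y := by
  rw [div_eq_mul_inv]
  exact (logHeight₁_mul_le x y⁻¹).trans (by rw [logHeight₁_inv])

/-- **Height of a root of a monic polynomial**: if `y^D + ∑_{k<D} b_k y^k = 0` (`D ≥ 1`) then
`H(y) ≤ D^{[F:ℚ]} ∏_k H(b_k)`. [cite: NesterenkoPhilippon2001, Ch. 2, Lemma 2.8] -/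
theorem mulHeight₁_root_le_of_monic {D : ℕ} (hD : 0 < D) (b : ℕ → F) {y : F}
    (hrel : y ^ D + ∑ k ∈ range D, b k * y ^ k = 0) :
    mulHeight₁ y ≤ (D : ℝ) ^ totalWeight F * ∏ k ∈ range D, mulHeight₁ (b k) := by
  have hone : ∀ v : AbsoluteValue F ℝ, 1 ≤ ∏ j ∈ range D, max (v (b j)) 1 := fun v =>
    one_le_prod fun j _ => le_max_right _ _
  have hsingle : ∀ (v : AbsoluteValue F ℝ), ∀ k ∈ range D, v (b k) ≤ ∏ j ∈ range D, max (v (b j)) 1 := by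
    intro v k hk
    have herase : 1 ≤ ∏ j ∈ (range D).erase k, max (v (b j)) 1 :=
      one_le_prod fun j _ => le_max_right _ _
    calc v (b k) ≤ max (v (b k)) 1 * 1 := by rw [mul_one]; exact le_max_left _ _
      _ ≤ max (v (b k)) 1 * ∏ j ∈ (range D).erase k, max (v (b j)) 1 :=
          mul_le_mul_of_nonneg_left herase (le_trans zero_le_one (le_max_right _ _))
      _ = ∏ j ∈ range D, max (v (b j)) 1 := mul_prod_erase (range D) (fun j => max (v (b j)) 1) hk
  have h := mulHeight₁_le_of_forall_absValue_le (K := F) (range D) (y := y) (x := b) (e := fun _ => 1)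
    (C := D) (by exact_mod_cast hD) (fun v _ => ?_) (fun v hv => ?_)
  · simpa only [pow_one] using h
  · -- archimedean places: `v y ≤ max(1, ∑ v b_k) ≤ D ∏ max(v b_k, 1)`
    refine (absValue_le_max_one_sum_of_monic v b hrel).trans (max_le ?_ ?_)
    · simpa only [pow_one, one_mul] using
        mul_le_mul (show (1 : ℝ) ≤ D by exact_mod_cast hD) (hone v) zero_le_one (Nat.cast_nonneg _)
    · calc ∑ k ∈ range D, v (b k) ≤ ∑ _k ∈ range D, ∏ j ∈ range D, max (v (b j)) 1 :=
            Finset.sum_le_sum (hsingle v)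
        _ = D * ∏ j ∈ range D, max (v (b j)) 1 ^ 1 := by
            rw [sum_const, card_range, nsmul_eq_mul]
            simp only [pow_one]
  · -- non-archimedean places: ultrametric
    refine (absValue_le_max_one_sup_of_monic (isNonarchimedean v hv) b hrel
      (B := ∏ j ∈ range D, max (v (b j)) 1) (fun k hk => hsingle v k (mem_range.mpr hk))).trans ?_
    rw [max_eq_right (hone v)]
    simp only [pow_one, le_refl]

/-- Logarithmic form: `h(y) ≤ [F:ℚ] log D + ∑_k h(b_k)`. [cite: NesterenkoPhilippon2001, Ch. 2, Lemma 2.8] -/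
theorem logHeight₁_root_le_of_monic {D : ℕ} (hD : 0 < D) (b : ℕ → F) {y : F}
    (hrel : y ^ D + ∑ k ∈ range D, b k * y ^ k = 0) :
    logHeight₁ y ≤ totalWeight F * Real.log D + ∑ k ∈ range D, logHeight₁ (b k) := by
  have h := mulHeight₁_root_le_of_monic hD b hrel
  have hlog := Real.log_le_log (mulHeight₁_pos _) h
  rw [Real.log_mul (by positivity) (prod_pos fun k _ => mulHeight₁_pos _).ne', Real.log_pow,
    Real.log_prod (fun k _ => (mulHeight₁_pos _).ne')] at hlog
  simpa only [logHeight₁_eq_log_mulHeight₁] using hlog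

/-- **The affine height of a tuple is at most the sum of the heights of its entries**:
`h(1, y₁, …, yₙ) ≤ ∑ h(yₛ)` (the tuple is a sub-tuple of the Segre multiplication table of the
pairs `(1, yₛ)`). [folklore] -/
theorem logHeight_optionElim_le_sum {σ : Type*} [Fintype σ] [DecidableEq σ] (y : σ → F) :
    logHeight (fun o : Option σ => o.elim (1 : F) y) ≤ ∑ s, logHeight₁ (y s) := by
  -- the pairs `(1, yₛ)` indexed by `Option Unit`
  set x : σ → Option Unit → F := fun s o => o.elim (1 : F) (fun _ => y s) with hx
  have hx0 : ∀ s, x s ≠ 0 := fun s h => by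
    have := congrFun h none
    simp [hx] at this
  have htable := logHeight_fun_prod_eq (x := x) hx0
  -- the tuple as a sub-tuple of the table
  set f : Option σ → (σ → Option Unit) := fun o t => Option.elim o none (fun s => if t = s then some () else none)
    with hf
  have hsub : (fun o : Option σ => o.elim (1 : F) y) = (fun I : σ → Option Unit => ∏ s, x s (I s)) ∘ f := by
    funext o
    cases o with
    | none => simp [hf, hx]
    | some s =>
      simp only [Function.comp_apply, hf, Option.elim_some]
      rw [Finset.prod_eq_single s]
      · simp [hx]
      · intro t _ hts
        simp [hx, hts]
      · intro h; exact absurd (Finset.mem_univ s) h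
  rw [hsub]
  refine (logHeight_comp_le f _).trans ?_
  rw [htable]
  refine le_of_eq (Finset.sum_congr rfl fun s _ => ?_)
  rw [logHeight₁_eq_logHeight]
  have e : x s = ![y s, 1] ∘ optionUnitEquivFinTwo := by
    funext o; cases o <;> simp [hx, optionUnitEquivFinTwo]
  rw [e, logHeight_comp_equiv]

end general

/-! ### The normalised heights `weilHeight₁` of the tree -/

/-- `h₁(y₁, …, yₙ) ≤ ∑ₛ h₁(yₛ)` for the tree's normalised affine height in a number field
`E ⊂ ℂ`. [folklore] -/
theorem weilHeight₁_le_sum_single (E : IntermediateField ℚ ℂ) [FiniteDimensional ℚ E] {σ : Type*}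
    [Fintype σ] (y : σ → ℂ) (hy : ∀ s, y s ∈ E) :
    weilHeight₁ E y ≤ ∑ s, weilHeight₁ E (fun _ : Unit => y s) := by
  classical
  haveI : NumberField E := numberField_of_intermediateField E
  rw [weilHeight₁_eq E y hy, optionElim_coe_eq E y hy]
  rw [Finset.sum_congr rfl fun s _ => weilHeight₁_single_eq E (hy s), ← Finset.sum_div]
  apply div_le_div_of_nonneg_right _ (Nat.cast_nonneg _)
  exact logHeight_optionElim_le_sum fun s => (⟨y s, hy s⟩ : E)

end RoyWaldschmidt1997

end Literature.NumberTheory.Transcendental
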